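import Summits.QuantumFields.QCD.Theorems.PauliWegnerSeaChiralOneScaleTrajectoryPinOfLatticeLightness
import Summits.QuantumFields.QCD.Theorems.LightQuarkCompletion.Negative.Anatomy

/-!
# Crux `LightQuarkCompletion` (stmt-QuantumFields-18066), line `Sketch`, stub J (`stub_jumpLineIsChiral`) — the EDGE to route
# PauliWegnerSea's landed ∀reg chirality engine (lead c5, cycle 5; kernel-checked bookkeeping, NOT a supplier)

`Cruxes.ChiralOneScaleTrajectory.LogConvexLift.isChiralAtZero_of_latticeLightness_of_hasAsymptoticScaling` (landed 2026-08-17T08:19Z,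
line `log-convex-continuum-lift` of crux stmt-QuantumFields-17512): for EVERY regularisation with two-loop asymptotic scaling
(`N_f ≤ 16`) whose realised bare trajectories stay on Lüscher's branch, `LOGROOM ∧ TWIST ∧ LIGHT → IsChiralAtZero` (odd-torus site RP,
translation invariance of the antiperiodic functional, log-convexity; no sign input).

`stub_jumpLineIsChiral_of_latticeLightness` below records what this does for stub J of `Lines/Sketch.lean`: the hypotheses of J
(mass scaling, asymptotic scaling, `m_crit' → 0`, two-sided pin at zero threshold, body at every positive tuple) supply the engine's
first two inputs (asymptotic scaling verbatim; the branch from the body's `IsQCDAlong` clause, `body_branch_sliver` at threshold `0`),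
so J holds for every such `reg'` that ALSO satisfies `LOGROOM reg'` (superlogarithmic physical volume `a_k L_k / (1 + |log a_k|) → ∞`),
`TWIST N_f reg'` (the `(−1)^F` twist invisible at log-scale separations at `S = L_k`) and `LIGHT N_f reg'` (lattice lightness of the
flavoured pion at two even times within a fixed physical distance, frequently in `k`).  Reading: LIGHT for a ZERO-PINNED regularisation
is the physics core of J ("the parity-jump line is the chiral line: the pion of the pinned regularisation becomes light as `m → 0⁺`");
TWIST is the fermionic-gap technicality; LOGROOM is a volume side condition that the crux's hypotheses do NOT provide (the witness of
either composition inherits `reg.L` through the body's `IsQCDAlong`, and no subsequence of a merely divergent `a_k L_k` need be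
superlogarithmic) — it is free for any honest construction, so the cheap place to add it is the threshold package the bridge
`SeaFactorisationBridge` outputs.  Nothing here proves physics.  Pure bookkeeping; standard axioms.
-/

noncomputable section

namespace Summit.QuantumFields.QCD.Theorems.LightQuarkJumpLine

open scoped BigOperators Topology ComplexOrder
open MeasureTheory Filter
open Literature.MathematicalPhysics.QuantumFieldTheory Literature.MathematicalPhysics.QuantumLattice
  Literature.Probability.LatticeModels
open Summit.QuantumFields.QCD.Theorems.CoerciveSeaNegative (PinClause)
open Summit.QuantumFields.QCD.Theorems.EarlyCrosserLawNegative (UpperPin)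

/-! ### NOTATION PRELUDE of line `log-convex-continuum-lift` (verbatim; expands to tree declarations only) -/

local notation "SU3" => Matrix.specialUnitaryGroup (Fin 3) ℂ

local notation "nAP⟪" β ", " S ", " mq ", " f ", " g ", " v "⟫" =>
  (∫ U : GaugeConfig 4 (2 * S + 1) (Matrix.specialUnitaryGroup (Fin 3) ℂ),
      fermiIntegral (torusBilinear g f (Torus.proj (2 * S + 1) 0) (Torus.proj (2 * S + 1) 0) gammaFive 1 *
          torusBilinear f g (Torus.proj (2 * S + 1) v) (Torus.proj (2 * S + 1) v) gammaFive 1 *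
        fermiBoltzmannAP U mq)
    ∂(wilsonMeasure (fundamentalRep (Fin 3)) β))

local notation "nP⟪" β ", " S ", " mq ", " f ", " g ", " v "⟫" =>
  (∫ U : GaugeConfig 4 (2 * S + 1) (Matrix.specialUnitaryGroup (Fin 3) ℂ),
      fermiIntegral (torusBilinear g f (Torus.proj (2 * S + 1) 0) (Torus.proj (2 * S + 1) 0) gammaFive 1 *
          torusBilinear f g (Torus.proj (2 * S + 1) v) (Torus.proj (2 * S + 1) v) gammaFive 1 *
        fermiBoltzmann U mq)
    ∂(wilsonMeasure (fundamentalRep (Fin 3)) β))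

local notation "zAP⟪" β ", " S ", " mq "⟫" =>
  (∫ U : GaugeConfig 4 (2 * S + 1) (Matrix.specialUnitaryGroup (Fin 3) ℂ),
      fermiIntegral (fermiBoltzmannAP U mq) ∂(wilsonMeasure (fundamentalRep (Fin 3)) β))

local notation "zP⟪" β ", " S ", " mq "⟫" =>
  (∫ U : GaugeConfig 4 (2 * S + 1) (Matrix.specialUnitaryGroup (Fin 3) ℂ),
      fermiIntegral (fermiBoltzmann U mq) ∂(wilsonMeasure (fundamentalRep (Fin 3)) β))

local notation "dAP⟪" β ", " S ", " mq ", " f ", " g ", " T ", " h ", " n "⟫" =>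
  (∑ z ∈ (T : Finset (Literature.Probability.LatticeModels.Site 4)),
    ∑ z' ∈ (T : Finset (Literature.Probability.LatticeModels.Site 4)),
      (((h : Literature.Probability.LatticeModels.Site 4 → ℝ) z * h z' : ℝ) : ℂ) *
        nAP⟪β, S, mq, f, g, (Pi.single (0 : Fin 4) (((n : ℕ) : ℤ)) + (z' - z))⟫)

-- `APTI⟪Nf⟫`: translation invariance of the un-normalised antiperiodic two-bilinear functional.
set_option quotPrecheck false in
local notation "APTI⟪" Nf "⟫" =>
  (∀ (β : ℝ) (S : ℕ) (mq : Fin Nf → ℝ) (f g f' g' : Fin Nf) (Γ Γ' : Matrix (Fin 4) (Fin 4) ℂ)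
      (x y u : TorusSite 4 (2 * S + 1)),
    (∫ U : GaugeConfig 4 (2 * S + 1) (Matrix.specialUnitaryGroup (Fin 3) ℂ),
        fermiIntegral (torusBilinear f g x x Γ 1 * torusBilinear f' g' y y Γ' 1 * fermiBoltzmannAP U mq)
      ∂(wilsonMeasure (fundamentalRep (Fin 3)) β)) =
    ∫ U : GaugeConfig 4 (2 * S + 1) (Matrix.specialUnitaryGroup (Fin 3) ℂ),
        fermiIntegral (torusBilinear f g (x + u) (x + u) Γ 1 * torusBilinear f' g' (y + u) (y + u) Γ' 1 *
          fermiBoltzmannAP U mq)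
      ∂(wilsonMeasure (fundamentalRep (Fin 3)) β))

-- `TP⟪Nf⟫`: the RP–Hankel form of transfer positivity (even separations, phase `u`).
set_option quotPrecheck false in
local notation "TP⟪" Nf "⟫" =>
  (∀ (β : ℝ), 0 ≤ β → ∀ (S : ℕ), 1 ≤ S → ∀ (mq : Fin Nf → ℝ), (∀ fl, -1 < mq fl) → ∀ (f g : Fin Nf),
    ∃ u : ℂ, ‖u‖ = 1 ∧
      (∀ (T : Finset (Literature.Probability.LatticeModels.Site 4)) (h : Literature.Probability.LatticeModels.Site 4 → ℝ),
        (∀ z ∈ T, z 0 = 0 ∧ ∀ i, |z i| ≤ (S : ℤ)) →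
        ∀ (s t : ℕ), 1 ≤ s → s ≤ S → 1 ≤ t → t ≤ S →
          0 ≤ u * dAP⟪β, S, mq, f, g, T, h, 2 * s⟫ ∧
          ‖dAP⟪β, S, mq, f, g, T, h, s + t⟫‖ ^ 2 ≤
            (u * dAP⟪β, S, mq, f, g, T, h, 2 * s⟫).re * (u * dAP⟪β, S, mq, f, g, T, h, 2 * t⟫).re) ∧
      (∀ (t : ℕ) (w : Literature.Probability.LatticeModels.Site 4), 1 ≤ t → t ≤ S → w 0 = 0 →
        (∀ i, |w i| ≤ (S : ℤ)) →
          ‖nAP⟪β, S, mq, f, g, (Pi.single (0 : Fin 4) (((2 * t : ℕ) : ℤ)) + w)⟫‖ ≤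
            (u * nAP⟪β, S, mq, f, g, (Pi.single (0 : Fin 4) (((2 * t : ℕ) : ℤ)))⟫).re))

-- `CHORD`: local log-convexity of a non-negative finite sequence gives the three-point chord inequality.
set_option quotPrecheck false in
local notation "CHORD" =>
  (∀ (e : ℕ → ℝ) (N : ℕ), (∀ j, 1 ≤ j → j ≤ N → 0 ≤ e j) →
    (∀ j, 2 ≤ j → j + 1 ≤ N → e j ^ 2 ≤ e (j - 1) * e (j + 1)) →
    ∀ i j k : ℕ, 1 ≤ i → i < j → j < k → k ≤ N → e j ^ (k - i) ≤ e i ^ (k - j) * e k ^ (j - i))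

-- `LOGROOM⟪reg⟫`: superlogarithmic physical volume.
set_option quotPrecheck false in
local notation "LOGROOM⟪" reg "⟫" =>
  (Tendsto (fun k => QCDRegularisation.a reg k * (QCDRegularisation.L reg k : ℝ) /
    (1 + |Real.log (QCDRegularisation.a reg k)|)) atTop atTop)

-- `TWIST⟪Nf, reg⟫`: the `(−1)^F` twist is invisible at log-scale separations, at `S = L_k`, eventually.
set_option quotPrecheck false in
local notation "TWIST⟪" Nf ", " reg "⟫" =>
  (∀ (m : Fin Nf → ℝ), (∀ fl, 0 < m fl) → ∀ (f g : Fin Nf), f ≠ g → ∀ K : ℝ, ∀ᶠ k in atTop,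
    2 * ‖zAP⟪QCDRegularisation.β reg k, QCDRegularisation.L reg k,
            fun fl => QCDRegularisation.mcrit reg k + QCDRegularisation.a reg k * m fl / QCDRegularisation.Zm reg k⟫ -
          zP⟪QCDRegularisation.β reg k, QCDRegularisation.L reg k,
            fun fl => QCDRegularisation.mcrit reg k + QCDRegularisation.a reg k * m fl / QCDRegularisation.Zm reg k⟫‖ ≤
      ‖zAP⟪QCDRegularisation.β reg k, QCDRegularisation.L reg k,
          fun fl => QCDRegularisation.mcrit reg k + QCDRegularisation.a reg k * m fl / QCDRegularisation.Zm reg k⟫‖ ∧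
    ∀ n : ℕ, (n : ℝ) * QCDRegularisation.a reg k ≤ K * (1 + |Real.log (QCDRegularisation.a reg k)|) →
      2 * ‖nAP⟪QCDRegularisation.β reg k, QCDRegularisation.L reg k,
              fun fl => QCDRegularisation.mcrit reg k + QCDRegularisation.a reg k * m fl / QCDRegularisation.Zm reg k,
              f, g, (Pi.single (0 : Fin 4) ((n : ℕ) : ℤ))⟫ -
            nP⟪QCDRegularisation.β reg k, QCDRegularisation.L reg k,
              fun fl => QCDRegularisation.mcrit reg k + QCDRegularisation.a reg k * m fl / QCDRegularisation.Zm reg k,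
              f, g, (Pi.single (0 : Fin 4) ((n : ℕ) : ℤ))⟫‖ ≤
        ‖nAP⟪QCDRegularisation.β reg k, QCDRegularisation.L reg k,
            fun fl => QCDRegularisation.mcrit reg k + QCDRegularisation.a reg k * m fl / QCDRegularisation.Zm reg k,
            f, g, (Pi.single (0 : Fin 4) ((n : ℕ) : ℤ))⟫‖)

-- `LIGHT⟪Nf, reg⟫`: LatticeLightness at EVEN lattice times `2n₁ < 2n₂` within a fixed physical distance, with a
-- polynomial floor relative to `‖Z_AP‖ > 0`, frequently in `k`, at `S = L_k`.
set_option quotPrecheck false in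
local notation "LIGHT⟪" Nf ", " reg "⟫" =>
  (∀ ε : ℝ, 0 < ε → ∃ m : Fin Nf → ℝ, (∀ fl, 0 < m fl) ∧ ∃ (f g : Fin Nf), f ≠ g ∧
    ∃ (R : ℝ) (p : ℕ) (C : ℝ), 0 < C ∧ ∃ᶠ k in atTop,
      ∃ (T : Finset (Literature.Probability.LatticeModels.Site 4)) (h : Literature.Probability.LatticeModels.Site 4 → ℝ)
        (n₁ n₂ : ℕ),
        1 ≤ n₁ ∧ n₁ < n₂ ∧ (n₂ : ℝ) * QCDRegularisation.a reg k ≤ R ∧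
        (∀ z ∈ T, z 0 = 0 ∧ ∀ i, |z i| ≤ (n₂ : ℤ)) ∧
        0 < ∑ z ∈ T, |h z| ∧
        0 < ‖zAP⟪QCDRegularisation.β reg k, QCDRegularisation.L reg k,
              fun fl => QCDRegularisation.mcrit reg k + QCDRegularisation.a reg k * m fl / QCDRegularisation.Zm reg k⟫‖ ∧
        C * QCDRegularisation.a reg k ^ p * ((∑ z ∈ T, |h z|) ^ 2 *
            ‖zAP⟪QCDRegularisation.β reg k, QCDRegularisation.L reg k,
              fun fl => QCDRegularisation.mcrit reg k + QCDRegularisation.a reg k * m fl / QCDRegularisation.Zm reg k⟫‖) ≤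
          ‖dAP⟪QCDRegularisation.β reg k, QCDRegularisation.L reg k,
              fun fl => QCDRegularisation.mcrit reg k + QCDRegularisation.a reg k * m fl / QCDRegularisation.Zm reg k,
              f, g, T, h, 2 * n₂⟫‖ ∧
        ‖dAP⟪QCDRegularisation.β reg k, QCDRegularisation.L reg k,
            fun fl => QCDRegularisation.mcrit reg k + QCDRegularisation.a reg k * m fl / QCDRegularisation.Zm reg k,
            f, g, T, h, 2 * n₁⟫‖ ≤
          ‖dAP⟪QCDRegularisation.β reg k, QCDRegularisation.L reg k,
              fun fl => QCDRegularisation.mcrit reg k + QCDRegularisation.a reg k * m fl / QCDRegularisation.Zm reg k,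
              f, g, T, h, 2 * n₂⟫‖ * Real.exp (ε * (QCDRegularisation.a reg k * ((n₂ : ℝ) - n₁))))


/-- **Stub J from the lattice-lightness package.**  For `N_f ∈ {2,3}` and a regularisation `reg'` with the hypotheses of
`stub_jumpLineIsChiral` (mass scaling, two-loop asymptotic scaling, `m_crit' → 0`, the two-sided parity pin at zero threshold, the
`QCDOf` body at every positive tuple): if `reg'` moreover has superlogarithmic volume (`LOGROOM`), twist-insensitivity (`TWIST`) and
lattice lightness (`LIGHT`), then `reg'.IsChiralAtZero` — by PauliWegnerSea's landed engine, the branch being read off the body.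
The pin, `m_crit' → 0` and mass scaling are not used: the engine replaces them by `LIGHT`. -/
theorem stub_jumpLineIsChiral_of_latticeLightness : ∀ Nf : ℕ, (Nf = 2 ∨ Nf = 3) → ∀ reg' : QCDRegularisation Nf,
    reg'.HasMassScaling → (reg'.scheme 0 0 0).HasAsymptoticScaling → Tendsto reg'.mcrit atTop (𝓝 0) →
    (∀ m : Fin Nf → ℝ, (∀ f, 0 < m f) → ∃ R : ℝ, 0 < R ∧ PinClause Nf reg' 0 m R ∧ UpperPin Nf reg' 0 m R) →
    (∀ m : Fin Nf → ℝ, (∀ f, 0 < m f) → ∃ (z shift : QCDField Nf → ℕ → ℝ) (T : OSData (QCDField Nf) 4),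
      IsQCDAlong (reg'.scheme m z shift) T ∧ T.IsNontrivial QCDField.glue ∧ T.IsNonGaussian QCDField.glue ∧
        (∀ f g : Fin Nf, f ≠ g → T.IsNontrivial (QCDField.pseudoRe f g)) ∧
          ∃ Δ > 0, T.HasMassGap Δ ∧ (reg'.scheme m z shift).HasLatticeMassGap Δ) →
    LOGROOM⟪reg'⟫ → TWIST⟪Nf, reg'⟫ → LIGHT⟪Nf, reg'⟫ → reg'.IsChiralAtZero := by
  intro Nf hNf reg' _hMS hAS _hlim _hpin hbody hroom htwist hlight
  have h16 : Nf ≤ 16 := by rcases hNf with rfl | rfl <;> norm_num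
  have hbr : ∀ m : Fin Nf → ℝ, (∀ f, 0 < m f) → ∀ f : Fin Nf, ∀ᶠ k in atTop,
      -1 < reg'.mcrit k + reg'.a k * m f / reg'.Zm k := fun m hm f =>
    Summit.QuantumFields.QCD.Theorems.LightQuarkCompletion.Negative.body_branch_sliver
      (reg := reg') (M₀ := 0) hbody m hm f
  exact Summit.QuantumFields.QCD.Cruxes.ChiralOneScaleTrajectory.LogConvexLift.isChiralAtZero_of_latticeLightness_of_hasAsymptoticScaling
    Nf h16 reg' hAS hbr hroom htwist hlight

end Summit.QuantumFields.QCD.Theorems.LightQuarkJumpLine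

end
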